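import Summits.CriticalPhenomena.PercolationContinuityZ3.Theorems.PercNearOneGluingNoHeavyLowerTailCoreExchange
import HarnessLib

/-!
# `NoHeavyLowerTail` (stmt-CriticalPhenomena-4575) — the random-core pair exchange reduced to a one-sided odds shift

Support file (prover `prim-lf-1`, lemma factory #1; `--supports stmt-CriticalPhenomena-4575`).  No definitions,
no named facts, no sorries.

The open step of the floating-sink line is the random-core pair exchange RC1 (`CoreExchange.lean`: inside an
ambient event `Γ`, `S_a · S_b ≤ T_a · T_b`; a THEOREM on Steiner-free supports, `steinerFree_corePairExchange`, and
in every census, open in general).  This file records the reduction found in the seat memo CANDIDATES.md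
BATCH 8/9 ("3×3 o/core table"): RC1 follows from the x4 form RC1′, and RC1′ follows from the ONE-SIDED ODDS SHIFT
  (T3_ab)  `μ(Γ D {o↔b} {b↮c}) · μ(Γ D {o↮b} {a↮c}) ≤ μ(Γ D {o↔b} {a↮c}) · μ(Γ D {o↮b} {b↮c})`,  `D = {a ↮ b}`,
together with its mirror image (T3_ba) (swap `a ↔ b`): "learning `o ∈ C_b` lowers the odds 'core avoids b : core
avoids a'".  The point of the reduction: (T3) compares `o ∈ C_b` only with `o ∉ C_b` (not with `o ∈ C_a`), so after
conditioning on `C_b` it is a statement about ONE cluster law with two explicit weights — the form in which the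
seat's `coreAttraction_sep` (T2) was proved.  The algebra: (T3_ab) gives `μ(ΓD{o↔b}{b↮c})·μ(ΓD{a↮c}) ≤
μ(ΓD{o↔b}{a↮c})·μ(ΓD{b↮c})`, (T3_ba) the mirror bound, and the two total masses cancel
(`corePairExchangePrime_of_oddsShift`); RC1′ ⟹ RC1 is monotonicity plus `{o↔b} ∩ {a↮b} = {o↔b} ∩ {o↮a}`
(`corePairExchange_of_oddsShift`); the floating-sink REG₂ / RWF₂ then follow by `CoreExchange.eventGluing_pair_within`
/ `worstFirst_two_mul_within`.  Everything holds for an ARBITRARY ambient event `Γ`.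
-/

noncomputable section

namespace Summit.CriticalPhenomena.PercolationContinuityZ3.Theorems

open MeasureTheory Set Literature.Probability.LatticeModels Literature.Probability.Percolation
open scoped Classical BigOperators

namespace CoreExchange

variable {n : ℕ}

/-- Splitting a real measure by an event and its complement: `μ(E ∩ A) + μ(E ∩ Aᶜ) = μ(E)`. [folklore] -/
theorem measureReal_inter_add_inter_compl' (w : Sym2 (Fin n) → unitInterval) (E A : Set (BondConfig (Fin n))) :
    (prodBernoulli w).real (E ∩ A) + (prodBernoulli w).real (E ∩ Aᶜ) = (prodBernoulli w).real E := by
  rw [← measureReal_inter_add_sdiff (μ := prodBernoulli w) (s := E) (MeasurableSet.of_discrete (s := A)),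
    Set.sdiff_eq]

/-- **RC1′ from the one-sided odds shift (pure measure algebra).**  For ANY events `Γ, D, Ob, Oa, Bc, Ac`
(read `Ob = {o↔b}`, `Oa = {o↔a}`, `Bc = {b↔c}`, `Ac = {a↔c}`, `D = {a↮b}`): if
`μ(ΓD Ob Bcᶜ)·μ(ΓD Obᶜ Acᶜ) ≤ μ(ΓD Ob Acᶜ)·μ(ΓD Obᶜ Bcᶜ)` (T3_ab) and
`μ(ΓD Oa Acᶜ)·μ(ΓD Oaᶜ Bcᶜ) ≤ μ(ΓD Oa Bcᶜ)·μ(ΓD Oaᶜ Acᶜ)` (T3_ba), then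
`μ(ΓD Ob Bcᶜ)·μ(ΓD Oa Acᶜ) ≤ μ(ΓD Ob Acᶜ)·μ(ΓD Oa Bcᶜ)` (RC1′). [this file] -/
theorem corePairExchangePrime_of_oddsShift (w : Sym2 (Fin n) → unitInterval)
    (E Ob Oa Bc Ac : Set (BondConfig (Fin n)))
    (h₁ : (prodBernoulli w).real (E ∩ Ob ∩ Bcᶜ) * (prodBernoulli w).real (E ∩ Obᶜ ∩ Acᶜ) ≤
      (prodBernoulli w).real (E ∩ Ob ∩ Acᶜ) * (prodBernoulli w).real (E ∩ Obᶜ ∩ Bcᶜ))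
    (h₂ : (prodBernoulli w).real (E ∩ Oa ∩ Acᶜ) * (prodBernoulli w).real (E ∩ Oaᶜ ∩ Bcᶜ) ≤
      (prodBernoulli w).real (E ∩ Oa ∩ Bcᶜ) * (prodBernoulli w).real (E ∩ Oaᶜ ∩ Acᶜ)) :
    (prodBernoulli w).real (E ∩ Ob ∩ Bcᶜ) * (prodBernoulli w).real (E ∩ Oa ∩ Acᶜ) ≤
      (prodBernoulli w).real (E ∩ Ob ∩ Acᶜ) * (prodBernoulli w).real (E ∩ Oa ∩ Bcᶜ) := by
  set μ := prodBernoulli w with hμ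
  -- the eight masses
  set P := μ.real (E ∩ Ob ∩ Bcᶜ) with hP
  set Q := μ.real (E ∩ Ob ∩ Acᶜ) with hQ
  set P' := μ.real (E ∩ Obᶜ ∩ Acᶜ) with hP'
  set Q' := μ.real (E ∩ Obᶜ ∩ Bcᶜ) with hQ'
  set U := μ.real (E ∩ Oa ∩ Acᶜ) with hU
  set X := μ.real (E ∩ Oa ∩ Bcᶜ) with hX
  set U' := μ.real (E ∩ Oaᶜ ∩ Bcᶜ) with hU'
  set X' := μ.real (E ∩ Oaᶜ ∩ Acᶜ) with hX'
  -- the two total masses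
  set MF := μ.real (E ∩ Bcᶜ) with hMF
  set MB := μ.real (E ∩ Acᶜ) with hMB
  have sF1 : P + Q' = MF := by
    have := measureReal_inter_add_inter_compl' w (E ∩ Bcᶜ) Ob
    rw [show E ∩ Bcᶜ ∩ Ob = E ∩ Ob ∩ Bcᶜ from by ext x; simp only [mem_inter_iff, mem_compl_iff]; tauto,
      show E ∩ Bcᶜ ∩ Obᶜ = E ∩ Obᶜ ∩ Bcᶜ from by ext x; simp only [mem_inter_iff, mem_compl_iff]; tauto] at this
    exact this
  have sF2 : X + U' = MF := by
    have := measureReal_inter_add_inter_compl' w (E ∩ Bcᶜ) Oa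
    rw [show E ∩ Bcᶜ ∩ Oa = E ∩ Oa ∩ Bcᶜ from by ext x; simp only [mem_inter_iff, mem_compl_iff]; tauto,
      show E ∩ Bcᶜ ∩ Oaᶜ = E ∩ Oaᶜ ∩ Bcᶜ from by ext x; simp only [mem_inter_iff, mem_compl_iff]; tauto] at this
    exact this
  have sB1 : Q + P' = MB := by
    have := measureReal_inter_add_inter_compl' w (E ∩ Acᶜ) Ob
    rw [show E ∩ Acᶜ ∩ Ob = E ∩ Ob ∩ Acᶜ from by ext x; simp only [mem_inter_iff, mem_compl_iff]; tauto,
      show E ∩ Acᶜ ∩ Obᶜ = E ∩ Obᶜ ∩ Acᶜ from by ext x; simp only [mem_inter_iff, mem_compl_iff]; tauto] at this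
    exact this
  have sB2 : U + X' = MB := by
    have := measureReal_inter_add_inter_compl' w (E ∩ Acᶜ) Oa
    rw [show E ∩ Acᶜ ∩ Oa = E ∩ Oa ∩ Acᶜ from by ext x; simp only [mem_inter_iff, mem_compl_iff]; tauto,
      show E ∩ Acᶜ ∩ Oaᶜ = E ∩ Oaᶜ ∩ Acᶜ from by ext x; simp only [mem_inter_iff, mem_compl_iff]; tauto] at this
    exact this
  have hP0 : 0 ≤ P := measureReal_nonneg
  have hQ0 : 0 ≤ Q := measureReal_nonneg
  have hP'0 : 0 ≤ P' := measureReal_nonneg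
  have hQ'0 : 0 ≤ Q' := measureReal_nonneg
  have hU0 : 0 ≤ U := measureReal_nonneg
  have hX0 : 0 ≤ X := measureReal_nonneg
  have hU'0 : 0 ≤ U' := measureReal_nonneg
  have hX'0 : 0 ≤ X' := measureReal_nonneg
  -- `P · MB ≤ Q · MF` and `U · MF ≤ X · MB`
  have k1 : P * MB ≤ Q * MF := by rw [← sB1, ← sF1]; nlinarith [h₁]
  have k2 : U * MF ≤ X * MB := by rw [← sF2, ← sB2]; nlinarith [h₂]
  have hMF0 : 0 ≤ MF := measureReal_nonneg
  have hMB0 : 0 ≤ MB := measureReal_nonneg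
  have hPle : P ≤ MF := by rw [← sF1]; linarith
  have hUle : U ≤ MB := by rw [← sB2]; linarith
  -- conclude: `P U (MF MB) ≤ Q X (MF MB)`; degenerate totals force `P = 0` or `U = 0`
  by_cases hF : MF = 0
  · have : P = 0 := le_antisymm (hF ▸ hPle) hP0
    rw [this, zero_mul]; exact mul_nonneg hQ0 hX0
  by_cases hB : MB = 0
  · have : U = 0 := le_antisymm (hB ▸ hUle) hU0
    rw [this, mul_zero]; exact mul_nonneg hQ0 hX0
  have hFpos : 0 < MF := lt_of_le_of_ne hMF0 (Ne.symm hF)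
  have hBpos : 0 < MB := lt_of_le_of_ne hMB0 (Ne.symm hB)
  have k3 : (P * U) * (MB * MF) ≤ (Q * X) * (MB * MF) := by
    have := mul_le_mul k1 k2 (mul_nonneg hU0 hMF0) (mul_nonneg hQ0 hMF0)
    nlinarith [this]
  exact le_of_mul_le_mul_right k3 (mul_pos hBpos hFpos)

/-- **RC1 from the one-sided odds shift.**  Inside any ambient event `Γ`, with `D = {a ↮ b}`: the two odds-shift
inequalities (T3_ab), (T3_ba) imply the random-core pair exchange in the form used by
`eventGluing_pair_within` / `worstFirst_two_mul_within`:
`μ(Γ ∩ {o↮a} ∩ {o↮c} ∩ {o↔b}) · μ(Γ ∩ {o↮b} ∩ {o↮c} ∩ {o↔a}) ≤ μ(Γ ∩ {o↮a} ∩ {a↮c}) · μ(Γ ∩ {o↮b} ∩ {b↮c})`.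
[this file] -/
theorem corePairExchange_of_oddsShift (w : Sym2 (Fin n) → unitInterval) (Γ : Set (BondConfig (Fin n)))
    (o a b c : Fin n)
    (h₁ : (prodBernoulli w).real (Γ ∩ (openConn a b : Set (BondConfig (Fin n)))ᶜ ∩ openConn o b ∩ (openConn b c)ᶜ) *
        (prodBernoulli w).real (Γ ∩ (openConn a b : Set (BondConfig (Fin n)))ᶜ ∩ (openConn o b)ᶜ ∩ (openConn a c)ᶜ) ≤
      (prodBernoulli w).real (Γ ∩ (openConn a b : Set (BondConfig (Fin n)))ᶜ ∩ openConn o b ∩ (openConn a c)ᶜ) *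
        (prodBernoulli w).real (Γ ∩ (openConn a b : Set (BondConfig (Fin n)))ᶜ ∩ (openConn o b)ᶜ ∩ (openConn b c)ᶜ))
    (h₂ : (prodBernoulli w).real (Γ ∩ (openConn a b : Set (BondConfig (Fin n)))ᶜ ∩ openConn o a ∩ (openConn a c)ᶜ) *
        (prodBernoulli w).real (Γ ∩ (openConn a b : Set (BondConfig (Fin n)))ᶜ ∩ (openConn o a)ᶜ ∩ (openConn b c)ᶜ) ≤
      (prodBernoulli w).real (Γ ∩ (openConn a b : Set (BondConfig (Fin n)))ᶜ ∩ openConn o a ∩ (openConn b c)ᶜ) *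
        (prodBernoulli w).real (Γ ∩ (openConn a b : Set (BondConfig (Fin n)))ᶜ ∩ (openConn o a)ᶜ ∩ (openConn a c)ᶜ)) :
    (prodBernoulli w).real (Γ ∩ (openConn o a : Set (BondConfig (Fin n)))ᶜ ∩ (openConn o c)ᶜ ∩ openConn o b) *
        (prodBernoulli w).real (Γ ∩ (openConn o b : Set (BondConfig (Fin n)))ᶜ ∩ (openConn o c)ᶜ ∩ openConn o a) ≤
      (prodBernoulli w).real (Γ ∩ (openConn o a : Set (BondConfig (Fin n)))ᶜ ∩ (openConn a c)ᶜ) *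
        (prodBernoulli w).real (Γ ∩ (openConn o b : Set (BondConfig (Fin n)))ᶜ ∩ (openConn b c)ᶜ) := by
  set μ := prodBernoulli w with hμ
  set E : Set (BondConfig (Fin n)) := Γ ∩ (openConn a b : Set (BondConfig (Fin n)))ᶜ with hE
  -- RC1′ by the measure algebra
  have key := corePairExchangePrime_of_oddsShift w E (openConn o b) (openConn o a) (openConn b c) (openConn a c)
    (by simpa only [hE, inter_assoc] using h₁) (by simpa only [hE, inter_assoc] using h₂)
  -- reachability bookkeeping
  have rS : ∀ (x y z : Fin n) (ω : BondConfig (Fin n)), ω ∈ (openConn x y : Set (BondConfig (Fin n))) →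
      (ω ∈ (openConn x z : Set (BondConfig (Fin n))) ↔ ω ∈ (openConn y z : Set (BondConfig (Fin n)))) := by
    intro x y z ω hxy
    change (openGraph ω).Reachable x y at hxy
    change (openGraph ω).Reachable x z ↔ (openGraph ω).Reachable y z
    exact ⟨fun h => hxy.symm.trans h, fun h => hxy.trans h⟩
  have abba : ∀ ω : BondConfig (Fin n), ω ∈ (openConn a b : Set (BondConfig (Fin n))) ↔
      ω ∈ (openConn b a : Set (BondConfig (Fin n))) := fun ω =>
    ⟨fun h => (show (openGraph ω).Reachable a b from h).symm, fun h => (show (openGraph ω).Reachable b a from h).symm⟩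
  -- `S_a`, `S_b` rewritten
  have eSa : (Γ ∩ (openConn o a : Set (BondConfig (Fin n)))ᶜ ∩ (openConn o c)ᶜ ∩ openConn o b) =
      E ∩ openConn o b ∩ (openConn b c)ᶜ := by
    ext ω
    constructor
    · rintro ⟨⟨⟨hΓ, hoa⟩, hoc⟩, hob⟩
      refine ⟨⟨⟨hΓ, fun hab => hoa ?_⟩, hob⟩, fun hbc => hoc ((rS o b c ω hob).2 hbc)⟩
      exact (rS o b a ω hob).2 ((abba ω).1 hab)
    · rintro ⟨⟨⟨hΓ, hab⟩, hob⟩, hbc⟩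
      refine ⟨⟨⟨hΓ, fun hoa => hab ?_⟩, fun hoc => hbc ((rS o b c ω hob).1 hoc)⟩, hob⟩
      exact (abba ω).2 ((rS o b a ω hob).1 hoa)
  have eSb : (Γ ∩ (openConn o b : Set (BondConfig (Fin n)))ᶜ ∩ (openConn o c)ᶜ ∩ openConn o a) =
      E ∩ openConn o a ∩ (openConn a c)ᶜ := by
    ext ω
    constructor
    · rintro ⟨⟨⟨hΓ, hob⟩, hoc⟩, hoa⟩
      exact ⟨⟨⟨hΓ, fun hab => hob ((rS o a b ω hoa).2 hab)⟩, hoa⟩, fun hac => hoc ((rS o a c ω hoa).2 hac)⟩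
    · rintro ⟨⟨⟨hΓ, hab⟩, hoa⟩, hac⟩
      exact ⟨⟨⟨hΓ, fun hob => hab ((rS o a b ω hoa).1 hob)⟩, fun hoc => hac ((rS o a c ω hoa).1 hoc)⟩, hoa⟩
  -- `T'_a ⊆ T_a`, `T'_b ⊆ T_b`
  have subA : E ∩ openConn o b ∩ (openConn a c)ᶜ ⊆
      Γ ∩ (openConn o a : Set (BondConfig (Fin n)))ᶜ ∩ (openConn a c)ᶜ := by
    rintro ω ⟨⟨⟨hΓ, hab⟩, hob⟩, hac⟩
    exact ⟨⟨hΓ, fun hoa => hab ((abba ω).2 ((rS o b a ω hob).1 hoa))⟩, hac⟩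
  have subB : E ∩ openConn o a ∩ (openConn b c)ᶜ ⊆
      Γ ∩ (openConn o b : Set (BondConfig (Fin n)))ᶜ ∩ (openConn b c)ᶜ := by
    rintro ω ⟨⟨⟨hΓ, hab⟩, hoa⟩, hbc⟩
    exact ⟨⟨hΓ, fun hob => hab ((rS o a b ω hoa).1 hob)⟩, hbc⟩
  rw [eSa, eSb]
  exact key.trans (mul_le_mul (measureReal_mono subA) (measureReal_mono subB) measureReal_nonneg measureReal_nonneg)

/-- **Floating-sink REG₂ from the odds shift**: with the two odds-shift inequalities for `(a,b)` and `(b,a)` inside `Γ`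
and both core-disconnections `≤ s`, the exit probability is `≤ s` (`eventGluing_pair_within`). [this file] -/
theorem coreEventGluing_pair_of_oddsShift (w : Sym2 (Fin n) → unitInterval) (Γ : Set (BondConfig (Fin n)))
    (o a b c : Fin n) (hab : a ≠ b) (s : ℝ)
    (h₁ : (prodBernoulli w).real (Γ ∩ (openConn a b : Set (BondConfig (Fin n)))ᶜ ∩ openConn o b ∩ (openConn b c)ᶜ) *
        (prodBernoulli w).real (Γ ∩ (openConn a b : Set (BondConfig (Fin n)))ᶜ ∩ (openConn o b)ᶜ ∩ (openConn a c)ᶜ) ≤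
      (prodBernoulli w).real (Γ ∩ (openConn a b : Set (BondConfig (Fin n)))ᶜ ∩ openConn o b ∩ (openConn a c)ᶜ) *
        (prodBernoulli w).real (Γ ∩ (openConn a b : Set (BondConfig (Fin n)))ᶜ ∩ (openConn o b)ᶜ ∩ (openConn b c)ᶜ))
    (h₂ : (prodBernoulli w).real (Γ ∩ (openConn a b : Set (BondConfig (Fin n)))ᶜ ∩ openConn o a ∩ (openConn a c)ᶜ) *
        (prodBernoulli w).real (Γ ∩ (openConn a b : Set (BondConfig (Fin n)))ᶜ ∩ (openConn o a)ᶜ ∩ (openConn b c)ᶜ) ≤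
      (prodBernoulli w).real (Γ ∩ (openConn a b : Set (BondConfig (Fin n)))ᶜ ∩ openConn o a ∩ (openConn b c)ᶜ) *
        (prodBernoulli w).real (Γ ∩ (openConn a b : Set (BondConfig (Fin n)))ᶜ ∩ (openConn o a)ᶜ ∩ (openConn a c)ᶜ))
    (ha : (prodBernoulli w).real (Γ ∩ (openConn a c : Set (BondConfig (Fin n)))ᶜ) ≤ s)
    (hb : (prodBernoulli w).real (Γ ∩ (openConn b c : Set (BondConfig (Fin n)))ᶜ) ≤ s) :
    (prodBernoulli w).real (Γ ∩ (openConn o c : Set (BondConfig (Fin n)))ᶜ ∩ ⋃ y ∈ ({a, b} : Finset (Fin n)),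
      openConn o y) ≤ s :=
  eventGluing_pair_within w Γ o c a b hab s (corePairExchange_of_oddsShift w Γ o a b c h₁ h₂) ha hb

/-- **Floating-sink RWF₂ from the odds shift** (`worstFirst_two_mul_within`). [this file] -/
theorem coreWorstFirst_two_mul_of_oddsShift (w : Sym2 (Fin n) → unitInterval) (Γ : Set (BondConfig (Fin n)))
    (o a b c : Fin n)
    (h₁ : (prodBernoulli w).real (Γ ∩ (openConn a b : Set (BondConfig (Fin n)))ᶜ ∩ openConn o b ∩ (openConn b c)ᶜ) *
        (prodBernoulli w).real (Γ ∩ (openConn a b : Set (BondConfig (Fin n)))ᶜ ∩ (openConn o b)ᶜ ∩ (openConn a c)ᶜ) ≤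
      (prodBernoulli w).real (Γ ∩ (openConn a b : Set (BondConfig (Fin n)))ᶜ ∩ openConn o b ∩ (openConn a c)ᶜ) *
        (prodBernoulli w).real (Γ ∩ (openConn a b : Set (BondConfig (Fin n)))ᶜ ∩ (openConn o b)ᶜ ∩ (openConn b c)ᶜ))
    (h₂ : (prodBernoulli w).real (Γ ∩ (openConn a b : Set (BondConfig (Fin n)))ᶜ ∩ openConn o a ∩ (openConn a c)ᶜ) *
        (prodBernoulli w).real (Γ ∩ (openConn a b : Set (BondConfig (Fin n)))ᶜ ∩ (openConn o a)ᶜ ∩ (openConn b c)ᶜ) ≤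
      (prodBernoulli w).real (Γ ∩ (openConn a b : Set (BondConfig (Fin n)))ᶜ ∩ openConn o a ∩ (openConn b c)ᶜ) *
        (prodBernoulli w).real (Γ ∩ (openConn a b : Set (BondConfig (Fin n)))ᶜ ∩ (openConn o a)ᶜ ∩ (openConn a c)ᶜ))
    (hworse : (prodBernoulli w).real (Γ ∩ (openConn b c : Set (BondConfig (Fin n)))ᶜ) ≤
      (prodBernoulli w).real (Γ ∩ (openConn a c : Set (BondConfig (Fin n)))ᶜ)) :
    (prodBernoulli w).real (Γ ∩ (openConn a c : Set (BondConfig (Fin n)))ᶜ) *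
        (prodBernoulli w).real (Γ ∩ (openConn o a : Set (BondConfig (Fin n)))ᶜ ∩ (openConn o c)ᶜ ∩ openConn o b) ≤
      (prodBernoulli w).real (Γ ∩ (openConn b c : Set (BondConfig (Fin n)))ᶜ) *
        (prodBernoulli w).real (Γ ∩ (openConn o a : Set (BondConfig (Fin n)))ᶜ ∩ (openConn a c)ᶜ) :=
  worstFirst_two_mul_within w Γ o c a b hworse (corePairExchange_of_oddsShift w Γ o a b c h₁ h₂)

end CoreExchange

end Summit.CriticalPhenomena.PercolationContinuityZ3.Theorems

end
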